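/-
Width seat `ym-line-cbag-p1-w3` (prover-ym-line-cbag-p1-w3-g10-0; own items stmt-QuantumFields-22254 / 22893 CLOSED proved).  Glue towards the
node `Theorems.TreeLevelLimitWitness`: the UPPER half of the six-plane DLR transfer at explicit exponents.  RECORD-type material; the Yang–Mills
mass gap is NOT proved by anything here.
-/
import Summits.QuantumFields.YangMills.Theorems.SixPlaneColdBoxTransferTorusSide
import Summits.QuantumFields.YangMills.Theorems.ColdBoxAllGroupsBulkAllGroupsStubLargeFieldRarityG
import Summits.QuantumFields.YangMills.Theorems.SixPlaneColdBoxTotalCovarianceUpper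
import Summits.QuantumFields.YangMills.Theorems.SixPlaneColdBoxGoodDatumCovUpper
import Summits.QuantumFields.YangMills.Theorems.SixPlaneColdBoxTransferBudgetUpper

/-!
# Route `SixPlaneColdBox`, glue: the UPPER six-plane DLR transfer at explicit exponents

`SixPlaneColdBox.sixPlaneTransfer_upper`: for every compact simple `G`, every `r : LatticeRep G` and `θ = 60A ≤ 1/200`, IF the torus plaquette
means exceed the cold-box centre means by at most `β^{−(1+3θ)}` (all large `β`, then all large odd tori; supplied by `torusMean_sub_boxMean_le_rpow`
for `θ ≤ θ₂(G, r)`), THEN for all large `β` and all large odd tori `β²·⟨F₀ ; F_{⌈β^A⌉e₀}⟩_torus ≤ β²·Cov_{box ⌈β^θ⌉}(F_c, F_{c+⌈β^A⌉e₀}) + β^{−9A}`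
for the six-plane cost sums `F` (the action density) — the upper half of the two-sided transfer (tree-level asymptotics RELATIVE to the cold box).
Assembly = mirror of `SixPlaneColdBoxTransferWithSlack`: `sixPlane_torusCorr_eq_kernel`, `total_covariance_upper_bound_dev` fed off the bad data
(`measureReal_badSetG_le`, `stub_largeFieldRarityG`) by `sixPlane_goodDatum_hup` (ceiling `θ₀ + Φ`, deviations `Ψ = β⁻¹(M_F⁺ + 12β^{−1/4})`, sup
`σ ≍ β^{2θ/5−1}`), `torusMean_eq_kernelMean_pairG` + the hypothesis + flat mean smoothness for the integrals, budget `transferBudgetUpper`.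
No sorry; no new definition; standard axioms.  NOT the Yang–Mills mass gap: glue for the RECORD-type node `TreeLevelLimitWitness`.
-/

set_option autoImplicit false

noncomputable section

open MeasureTheory ProbabilityTheory Finset Real Filter Topology Metric
open Literature.Probability.LatticeModels (Site glueWith)
open Literature.MathematicalPhysics.QuantumLattice Literature.MathematicalPhysics.QuantumFieldTheory
open Literature.MathematicalPhysics.QuantumFieldTheory.LatticeMaxwell Literature.MathematicalPhysics.QuantumFieldTheory.AxialGauge
open Summit.QuantumFields.YangMills.Theorems.WeakCouplingRates Summit.QuantumFields.YangMills.Theorems.FreeEnergyLogCoefficient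
open Summit.QuantumFields.YangMills.Theorems.ColdBoxAllGroups

namespace Summit.QuantumFields.YangMills.Theorems.SixPlaneColdBox

set_option maxHeartbeats 800000 in
/-- **The UPPER six-plane DLR transfer at explicit exponents.**  For every compact simple `G`, every `r : LatticeRep G` and `θ = 60A ≤ 1/200`:
if the torus plaquette means exceed the cold-box centre means (box `⌈β^θ⌉`) by at most `β^{−(1+3θ)}` for all large `β` and then all large odd
tori, then for all large `β` and then all large odd tori `2S+1`,
`β²·⟨F ; F⟩_{torus, ⌈β^A⌉} ≤ β²·Cov_{box ⌈β^θ⌉}(F_c, F_{c+⌈β^A⌉e₀}) + β^{−9A}` for the six-plane cost sums `F` (`actionDensity`). -/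
theorem sixPlaneTransfer_upper
    (G : Type) [Group G] [TopologicalSpace G] [IsTopologicalGroup G] [CompactSpace G] [MeasurableSpace G] [BorelSpace G]
    (hG : IsCompactSimpleLieGroup G) (r : LatticeRep G) {A θ : ℝ} (hA : 0 < A) (hA60 : 60 * A = θ) (hθ2 : θ ≤ 1 / 200)
    (hex : ∃ β₀ : ℝ, ∀ β : ℝ, β₀ ≤ β → ∃ S₀ : ℕ, ∀ S : ℕ, S₀ ≤ S → ∀ i j : Fin 4, i < j →
      (∫ U, plaqCost0 r.ρ i j (torusLift (2 * S + 1) U) ∂(wilsonMeasure (d := 4) (L := 2 * S + 1) r.ρ β)) -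
          (∫ U, plaqCostAt r.ρ (boxCentre ⌈β ^ θ⌉₊) i j U ∂(boxState r.ρ β ⌈β ^ θ⌉₊)) ≤ β ^ (-(1 + 3 * θ))) :
    ∃ β₀ : ℝ, ∀ β : ℝ, β₀ ≤ β → ∃ S₀ : ℕ, ∀ S : ℕ, S₀ ≤ S →
      β ^ 2 * latticeConnectedCorr r.ρ β (2 * S + 1) (actionDensity r.ρ) (actionDensity r.ρ) ⌈β ^ A⌉₊ ≤
        β ^ 2 * ((∫ U, (∑ q : {q : Fin 4 × Fin 4 // q.1 < q.2}, plaqCostAt r.ρ (boxCentre ⌈β ^ θ⌉₊) q.1.1 q.1.2 U) *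
                (∑ q : {q : Fin 4 × Fin 4 // q.1 < q.2}, plaqCostAt r.ρ (boxCentre ⌈β ^ θ⌉₊ + Pi.single 0 (⌈β ^ A⌉₊ : ℤ)) q.1.1 q.1.2 U) ∂(boxState r.ρ β ⌈β ^ θ⌉₊)) -
              (∫ U, ∑ q : {q : Fin 4 × Fin 4 // q.1 < q.2}, plaqCostAt r.ρ (boxCentre ⌈β ^ θ⌉₊) q.1.1 q.1.2 U ∂(boxState r.ρ β ⌈β ^ θ⌉₊)) *
                (∫ U, ∑ q : {q : Fin 4 × Fin 4 // q.1 < q.2}, plaqCostAt r.ρ (boxCentre ⌈β ^ θ⌉₊ + Pi.single 0 (⌈β ^ A⌉₊ : ℤ)) q.1.1 q.1.2 U ∂(boxState r.ρ β ⌈β ^ θ⌉₊))) +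
          β ^ (-(9 * A)) := by
  haveI : SecondCountableTopology G := r.secondCountableTopology
  obtain ⟨hρc, hρu⟩ : Continuous r.ρ ∧ ∀ g, r.ρ g ∈ Matrix.unitaryGroup (Fin r.N) ℂ := ⟨r.continuous, r.mem_unitary⟩
  obtain ⟨hθ, hAθ⟩ : 0 < θ ∧ A < θ := ⟨by linarith, by linarith⟩
  have hδ : (0 : ℝ) < θ / 5 := by positivity
  obtain ⟨K, hK0, CS, hCS0, βa, hupβ⟩ := sixPlane_goodDatum_hup G hG r hA hAθ hθ2
  have hfl := fun q : {q : Fin 4 × Fin 4 // q.1 < q.2} => goodBoundaryMeanSmoothG_allPlanes G hG r hA hAθ hθ2 q.1.1 q.1.2 q.2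
  choose Kf βf hKf using hfl
  obtain ⟨βc, hrare⟩ := stub_largeFieldRarityG G r (θ / 5) hδ
  obtain ⟨βT, hTβ⟩ := hex
  set cP : ℝ := (Fintype.card {q : Fin 4 × Fin 4 // q.1 < q.2} : ℝ) with hcP
  have hcP0 : 0 ≤ cP := Nat.cast_nonneg _
  set Nr : ℝ := (r.N : ℝ) with hNr
  have hNr0 : 0 ≤ Nr := Nat.cast_nonneg _
  set C₆ : ℝ := cP * (2 * Nr) with hC₆
  have hC₆0 : 0 ≤ C₆ := by positivity
  set SKf : ℝ := ∑ q, |Kf q| with hSKf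
  have hSKf0 : 0 ≤ SKf := Finset.sum_nonneg fun q _ => abs_nonneg _
  obtain ⟨βe, hβe⟩ := Filter.eventually_atTop.1 (transferBudgetUpper hA hA60 hθ2 hK0 hcP0 hSKf0 hCS0 hC₆0)
  refine ⟨max (max (max βT βa) βc) (max (max βe 1) (∑ q, |βf q|)), fun β hβ => ?_⟩
  simp only [max_le_iff] at hβ
  obtain ⟨⟨⟨hbT, hba⟩, hbc⟩, ⟨hbe, hβ1⟩, hbf⟩ := hβ
  have hβ0 : 0 < β := by linarith
  have hbfq : ∀ q, βf q ≤ β := fun q =>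
    ((le_abs_self _).trans (Finset.single_le_sum (f := fun q => |βf q|) (fun q _ => abs_nonneg _) (Finset.mem_univ q))).trans hbf
  have hH2 : (⌈β ^ θ⌉₊ : ℝ) ≤ 2 * β ^ θ := (one_le_ceil_rpow_and_le hβ1 hθ.le).2
  obtain ⟨S₁, hS₁⟩ := hTβ β hbT
  obtain ⟨L₀, hL₀⟩ := Filter.eventually_atTop.1 (hrare β hbc)
  refine ⟨max S₁ (max L₀ (2 * (2 * ⌈β ^ θ⌉₊ + ⌈β ^ A⌉₊ + 2))), fun S hS => ?_⟩
  simp only [max_le_iff] at hS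
  obtain ⟨hS1, hSL, hSbig⟩ := hS
  have hL : 2 * (2 * ⌈β ^ θ⌉₊ + ⌈β ^ A⌉₊ + 2) < 2 * S + 1 := by omega
  have hL2 := hL₀ (2 * S) (by omega)
  haveI := isProbabilityMeasure_wilsonMeasure (d := 4) (L := 2 * S + 1) (G := G) r.ρ hρc β
  haveI : IsProbabilityMeasure (boxState r.ρ β ⌈β ^ θ⌉₊) := isProbabilityMeasure_boxKernelG r.ρ hρc β ⌈β ^ θ⌉₊ (fun _ => 1)
  haveI hKprob : ∀ U : GaugeConfig 4 (2 * S + 1) G, IsProbabilityMeasure (boxKernelG r.ρ β ⌈β ^ θ⌉₊ (torusLift (2 * S + 1) U)) :=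
    fun U => isProbabilityMeasure_boxKernelG r.ρ hρc β ⌈β ^ θ⌉₊ _
  set F : LGConfig 4 G → ℝ := fun W => ∑ q : {q : Fin 4 × Fin 4 // q.1 < q.2},
    plaqCostAt r.ρ (boxCentre ⌈β ^ θ⌉₊) q.1.1 q.1.2 W with hF
  set F' : LGConfig 4 G → ℝ := fun W => ∑ q : {q : Fin 4 × Fin 4 // q.1 < q.2},
    plaqCostAt r.ρ (boxCentre ⌈β ^ θ⌉₊ + Pi.single 0 (⌈β ^ A⌉₊ : ℤ)) q.1.1 q.1.2 W with hF'
  set μ := wilsonMeasure (d := 4) (L := 2 * S + 1) r.ρ β with hμ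
  set h : GaugeConfig 4 (2 * S + 1) G → ℝ := fun U => ∫ W, F W ∂(boxKernelG r.ρ β ⌈β ^ θ⌉₊ (torusLift (2 * S + 1) U)) with hh
  set k : GaugeConfig 4 (2 * S + 1) G → ℝ := fun U => ∫ W, F' W ∂(boxKernelG r.ρ β ⌈β ^ θ⌉₊ (torusLift (2 * S + 1) U)) with hk
  set qf : GaugeConfig 4 (2 * S + 1) G → ℝ :=
    fun U => ∫ W, F W * F' W ∂(boxKernelG r.ρ β ⌈β ^ θ⌉₊ (torusLift (2 * S + 1) U)) with hqf
  have hFc : Continuous F := continuous_finsetSum _ fun q _ => continuous_plaqCostAtG r.ρ hρc _ q.1.1 q.1.2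
  have hFc' : Continuous F' := continuous_finsetSum _ fun q _ => continuous_plaqCostAtG r.ρ hρc _ q.1.1 q.1.2
  have hFK : ∀ W, |F W| ≤ C₆ := fun W => abs_sixPlaneSum_le r.ρ hρu _ W
  have hFK' : ∀ W, |F' W| ≤ C₆ := fun W => abs_sixPlaneSum_le r.ρ hρu _ W
  have hFFc : Continuous fun W => F W * F' W := hFc.mul hFc'
  have hFFK : ∀ W, |F W * F' W| ≤ C₆ ^ 2 := fun W => by
    rw [abs_mul, sq]; exact mul_le_mul (hFK W) (hFK' W) (abs_nonneg _) hC₆0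
  have hml := measurable_torusLift (d := 4) (G := G) (2 * S + 1)
  have hhm : Measurable h :=
    (continuous_integral_ymSpecification r.ρ hρc β (AxialGauge.boxEdges 4 (2 * ⌈β ^ θ⌉₊ + 1)) hFc hFK).measurable.comp hml
  have hkm : Measurable k :=
    (continuous_integral_ymSpecification r.ρ hρc β (AxialGauge.boxEdges 4 (2 * ⌈β ^ θ⌉₊ + 1)) hFc' hFK').measurable.comp hml
  have hqm : Measurable qf :=
    (continuous_integral_ymSpecification r.ρ hρc β (AxialGauge.boxEdges 4 (2 * ⌈β ^ θ⌉₊ + 1)) hFFc hFFK).measurable.comp hml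
  have hhK : ∀ U, |h U| ≤ C₆ := fun U => abs_integral_ymSpecification_le r.ρ hρc β _ hFK _
  have hkK : ∀ U, |k U| ≤ C₆ := fun U => abs_integral_ymSpecification_le r.ρ hρc β _ hFK' _
  have hqK : ∀ U, |qf U| ≤ C₆ ^ 2 := fun U => abs_integral_ymSpecification_le r.ρ hρc β _ hFFK _
  have bdd : ∀ {f : GaugeConfig 4 (2 * S + 1) G → ℝ} (C : ℝ), Measurable f → (∀ U, |f U| ≤ C) → Integrable f μ := fun C hf hC =>
    Integrable.of_bound hf.aestronglyMeasurable C (ae_of_all _ fun U => by simpa [Real.norm_eq_abs] using hC U)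
  have hhi : Integrable h μ := bdd C₆ hhm hhK
  have hki : Integrable k μ := bdd C₆ hkm hkK
  have hhU : ∀ U, h U = ∑ q : {q : Fin 4 × Fin 4 // q.1 < q.2},
      ∫ W, plaqCostAt r.ρ (boxCentre ⌈β ^ θ⌉₊) q.1.1 q.1.2 W ∂(boxKernelG r.ρ β ⌈β ^ θ⌉₊ (torusLift (2 * S + 1) U)) := fun U => by
    rw [hh]; simp only [hF]
    exact integral_finsetSum _ fun q _ => integrable_plaqCostAt_of_rep r.ρ hρc hρu _ _ _ _
  have hkU : ∀ U, k U = ∑ q : {q : Fin 4 × Fin 4 // q.1 < q.2},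
      ∫ W, plaqCostAt r.ρ (boxCentre ⌈β ^ θ⌉₊ + Pi.single 0 (⌈β ^ A⌉₊ : ℤ)) q.1.1 q.1.2 W
        ∂(boxKernelG r.ρ β ⌈β ^ θ⌉₊ (torusLift (2 * S + 1) U)) := fun U => by
    rw [hk]; simp only [hF']
    exact integral_finsetSum _ fun q _ => integrable_plaqCostAt_of_rep r.ρ hρc hρu _ _ _ _
  set E1F : ℝ := ∫ W, F W ∂(boxState r.ρ β ⌈β ^ θ⌉₊) with hE1F
  set E1F' : ℝ := ∫ W, F' W ∂(boxState r.ρ β ⌈β ^ θ⌉₊) with hE1F'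
  have hE1F_sum : E1F = ∑ q : {q : Fin 4 × Fin 4 // q.1 < q.2},
      ∫ W, plaqCostAt r.ρ (boxCentre ⌈β ^ θ⌉₊) q.1.1 q.1.2 W ∂(boxState r.ρ β ⌈β ^ θ⌉₊) := by
    rw [hE1F]; simp only [hF]; exact integral_finsetSum _ fun q _ => integrable_plaqCostAt_of_rep r.ρ hρc hρu _ _ _ _
  have hE1F'_sum : E1F' = ∑ q : {q : Fin 4 × Fin 4 // q.1 < q.2},
      ∫ W, plaqCostAt r.ρ (boxCentre ⌈β ^ θ⌉₊ + Pi.single 0 (⌈β ^ A⌉₊ : ℤ)) q.1.1 q.1.2 W ∂(boxState r.ρ β ⌈β ^ θ⌉₊) := by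
    rw [hE1F']; simp only [hF']; exact integral_finsetSum _ fun q _ => integrable_plaqCostAt_of_rep r.ρ hρc hρu _ _ _ _
  set E : Set (GaugeConfig 4 (2 * S + 1) G) := {U | torusLift (2 * S + 1) U ∈
      ⋃ z ∈ (Fintype.piFinset fun _ : Fin 4 => Finset.Icc (-1 : ℤ) (2 * (⌈β ^ θ⌉₊ : ℤ) + 1)) ×ˢ
          ((Finset.univ : Finset (Fin 4 × Fin 4)).filter fun q => q.1 < q.2),
        {W : LGConfig 4 G | β ^ (2 * (θ / 5) - 1) < plaqCostAt r.ρ z.1 z.2.1 z.2.2 W}} with hE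
  have hEm : MeasurableSet E := hml (measurableSet_badSetG r.ρ hρc β (θ / 5) ⌈β ^ θ⌉₊)
  have hgood : ∀ U, U ∉ E → CrudeGoodG r.ρ β (θ / 5) ⌈β ^ θ⌉₊ (torusLift (2 * S + 1) U) :=
    fun U hU => crudeGoodG_of_not_mem_badSet r.ρ hU
  set p : ℝ := ((6 * (2 * ⌈β ^ θ⌉₊ + 3) ^ 4 : ℕ) : ℝ) * Real.exp (-(β ^ (θ / 5))) with hp
  have hμE : μ.real E ≤ p := measureReal_badSetG_le r.ρ hρc hL2
  have hp0 : 0 ≤ p := by positivity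
  set θ0 : ℝ := (∫ W, F W * F' W ∂(boxState r.ρ β ⌈β ^ θ⌉₊)) - E1F * E1F' with hθ0
  set MF : GaugeConfig 4 (2 * S + 1) G → ℝ := fun U => β * h U - β * E1F + cP * (2 * β ^ (-(1 / 4 : ℝ))) with hMF
  set MF' : GaugeConfig 4 (2 * S + 1) G → ℝ := fun U => β * k U - β * E1F' + cP * (2 * β ^ (-(1 / 4 : ℝ))) with hMF'
  set c₁ : ℝ := (β ^ 2)⁻¹ * (K * β ^ (-(4 * A)) * cP) with hc₁
  have hc₁0 : 0 ≤ c₁ := by positivity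
  set c₀ : ℝ := (β ^ 2)⁻¹ * (cP ^ 2 * (2 * β ^ (-(1 / 5 : ℝ)))) with hc₀
  have hc₀0 : 0 ≤ c₀ := by positivity
  set Φ : GaugeConfig 4 (2 * S + 1) G → ℝ := fun U => c₁ * (max (MF U) 0 + max (MF' U) 0) + c₀ with hΦ
  set Ψ : GaugeConfig 4 (2 * S + 1) G → ℝ := fun U => β⁻¹ * (max (MF U) 0 + cP * (2 * β ^ (-(1 / 4 : ℝ)))) with hΨ
  set Ψ' : GaugeConfig 4 (2 * S + 1) G → ℝ := fun U => β⁻¹ * (max (MF' U) 0 + cP * (2 * β ^ (-(1 / 4 : ℝ)))) with hΨ'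
  set σ : ℝ := β⁻¹ * (cP * (CS * β ^ (2 * (θ / 5)) + 4 * β ^ (-(1 / 4 : ℝ))) + cP * (2 * β ^ (-(1 / 4 : ℝ)))) with hσ
  have hσ0 : 0 ≤ σ := by positivity
  have hMFm : Measurable MF := ((hhm.const_mul β).sub measurable_const).add measurable_const
  have hMFm' : Measurable MF' := ((hkm.const_mul β).sub measurable_const).add measurable_const
  have hΦm : Measurable Φ := (((hMFm.max measurable_const).add (hMFm'.max measurable_const)).const_mul c₁).add measurable_const
  have hΨm : Measurable Ψ := ((hMFm.max measurable_const).add measurable_const).const_mul _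
  have hΨm' : Measurable Ψ' := ((hMFm'.max measurable_const).add measurable_const).const_mul _
  set CM : ℝ := β * C₆ + β * C₆ + cP * 2 with hCM
  have hCM0 : 0 ≤ CM := by positivity
  have hβ14 : β ^ (-(1 / 4 : ℝ)) ≤ 1 := Real.rpow_le_one_of_one_le_of_nonpos hβ1 (by norm_num)
  have hβ140 : 0 ≤ β ^ (-(1 / 4 : ℝ)) := by positivity
  have hE1FK : |E1F| ≤ C₆ := abs_integral_le_of_abs_le _ hFK
  have hE1FK' : |E1F'| ≤ C₆ := abs_integral_le_of_abs_le _ hFK'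
  have h3 : cP * (2 * β ^ (-(1 / 4 : ℝ))) ≤ cP * 2 := mul_le_mul_of_nonneg_left (by linarith only [hβ14]) hcP0
  have h4 : 0 ≤ cP * (2 * β ^ (-(1 / 4 : ℝ))) := by positivity
  have hMFK : ∀ U, |MF U| ≤ CM := fun U => abs_affine_le (hhK U) hE1FK h4 h3 hβ0.le
  have hMFK' : ∀ U, |MF' U| ≤ CM := fun U => abs_affine_le (hkK U) hE1FK' h4 h3 hβ0.le
  have hΦK : ∀ U, |Φ U| ≤ c₁ * (CM + CM) + |c₀| := fun U => abs_floor_le (hMFK U) (hMFK' U) hc₁0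
  have hΨK : ∀ U, |Ψ U| ≤ β⁻¹ * (CM + cP * (2 * β ^ (-(1 / 4 : ℝ)))) := fun U => abs_dev_le (hMFK U) h4 hβ0
  have hΨK' : ∀ U, |Ψ' U| ≤ β⁻¹ * (CM + cP * (2 * β ^ (-(1 / 4 : ℝ)))) := fun U => abs_dev_le (hMFK' U) h4 hβ0
  have hΦi : Integrable Φ μ := bdd _ hΦm hΦK
  have hΨi : Integrable Ψ μ := bdd _ hΨm hΨK
  have hΨi' : Integrable Ψ' μ := bdd _ hΨm' hΨK'
  have hΦ0 : ∀ U, 0 ≤ Φ U := fun U => by rw [hΦ]; simp only; positivity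
  have hΨ0 : ∀ U, 0 ≤ Ψ U := fun U => by rw [hΨ]; simp only; positivity
  have hΨ'0 : ∀ U, 0 ≤ Ψ' U := fun U => by rw [hΨ']; simp only; positivity
  have sum_affine₁ : ∀ (a b : {q : Fin 4 × Fin 4 // q.1 < q.2} → ℝ) (c : ℝ),
      ∑ q, (β * a q - β * b q + c) = β * ∑ q, a q - β * ∑ q, b q + cP * c := fun a b c => by
    rw [Finset.sum_add_distrib, Finset.sum_sub_distrib, ← Finset.mul_sum, ← Finset.mul_sum, Finset.sum_const, Finset.card_univ, nsmul_eq_mul]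
  have hMF_eq : ∀ U, ∑ q : {q : Fin 4 × Fin 4 // q.1 < q.2},
      (β * (∫ W, plaqCostAt r.ρ (boxCentre ⌈β ^ θ⌉₊) q.1.1 q.1.2 W ∂(boxKernelG r.ρ β ⌈β ^ θ⌉₊ (torusLift (2 * S + 1) U))) -
        β * (∫ W, plaqCostAt r.ρ (boxCentre ⌈β ^ θ⌉₊) q.1.1 q.1.2 W ∂(boxState r.ρ β ⌈β ^ θ⌉₊)) + 2 * β ^ (-(1 / 4 : ℝ))) = MF U := by
    intro U
    rw [sum_affine₁, ← hhU U, ← hE1F_sum]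
  have hMF'_eq : ∀ U, ∑ q : {q : Fin 4 × Fin 4 // q.1 < q.2},
      (β * (∫ W, plaqCostAt r.ρ (boxCentre ⌈β ^ θ⌉₊ + Pi.single 0 (⌈β ^ A⌉₊ : ℤ)) q.1.1 q.1.2 W ∂(boxKernelG r.ρ β ⌈β ^ θ⌉₊ (torusLift (2 * S + 1) U))) -
        β * (∫ W, plaqCostAt r.ρ (boxCentre ⌈β ^ θ⌉₊ + Pi.single 0 (⌈β ^ A⌉₊ : ℤ)) q.1.1 q.1.2 W ∂(boxState r.ρ β ⌈β ^ θ⌉₊)) + 2 * β ^ (-(1 / 4 : ℝ))) = MF' U := by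
    intro U
    rw [sum_affine₁, ← hkU U, ← hE1F'_sum]
  have hMFnn : ∀ U, U ∉ E → 0 ≤ MF U ∧ 0 ≤ MF' U := fun U hU => by
    obtain ⟨hn1, hn2, -⟩ := hupβ β hba (torusLift (2 * S + 1) U) (hgood U hU)
    exact ⟨(hMF_eq U) ▸ Finset.sum_nonneg fun q _ => (hn1 q).1, (hMF'_eq U) ▸ Finset.sum_nonneg fun q _ => (hn2 q).1⟩
  have hMFsup : ∀ U, U ∉ E → MF U ≤ cP * (CS * β ^ (2 * (θ / 5)) + 4 * β ^ (-(1 / 4 : ℝ))) := fun U hU => by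
    obtain ⟨hn1, -, -⟩ := hupβ β hba (torusLift (2 * S + 1) U) (hgood U hU)
    rw [← hMF_eq U]
    calc _ ≤ ∑ _q : {q : Fin 4 × Fin 4 // q.1 < q.2}, (CS * β ^ (2 * (θ / 5)) + 4 * β ^ (-(1 / 4 : ℝ))) := Finset.sum_le_sum fun q _ => (hn1 q).2.1
      _ = cP * (CS * β ^ (2 * (θ / 5)) + 4 * β ^ (-(1 / 4 : ℝ))) := by rw [Finset.sum_const, Finset.card_univ, nsmul_eq_mul]
  have hβ2 : 0 < β ^ 2 := by positivity
  have hup : ∀ U, U ∉ E → qf U - h U * k U ≤ θ0 + Φ U := by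
    intro U hU
    obtain ⟨-, -, hmain⟩ := hupβ β hba (torusLift (2 * S + 1) U) (hgood U hU)
    obtain ⟨hMF0, hMF0'⟩ := hMFnn U hU
    have hss := sum_sum_affine
      (fun q : {q : Fin 4 × Fin 4 // q.1 < q.2} =>
        (β * (∫ W, plaqCostAt r.ρ (boxCentre ⌈β ^ θ⌉₊) q.1.1 q.1.2 W ∂(boxKernelG r.ρ β ⌈β ^ θ⌉₊ (torusLift (2 * S + 1) U))) -
        β * (∫ W, plaqCostAt r.ρ (boxCentre ⌈β ^ θ⌉₊) q.1.1 q.1.2 W ∂(boxState r.ρ β ⌈β ^ θ⌉₊)) + 2 * β ^ (-(1 / 4 : ℝ))))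
      (fun q : {q : Fin 4 × Fin 4 // q.1 < q.2} =>
        (β * (∫ W, plaqCostAt r.ρ (boxCentre ⌈β ^ θ⌉₊ + Pi.single 0 (⌈β ^ A⌉₊ : ℤ)) q.1.1 q.1.2 W ∂(boxKernelG r.ρ β ⌈β ^ θ⌉₊ (torusLift (2 * S + 1) U))) -
        β * (∫ W, plaqCostAt r.ρ (boxCentre ⌈β ^ θ⌉₊ + Pi.single 0 (⌈β ^ A⌉₊ : ℤ)) q.1.1 q.1.2 W ∂(boxState r.ρ β ⌈β ^ θ⌉₊)) + 2 * β ^ (-(1 / 4 : ℝ))))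
      (K * β ^ (-(4 * A))) (2 * β ^ (-(1 / 5 : ℝ)))
    beta_reduce at hss
    rw [hMF_eq U, hMF'_eq U] at hss
    rw [hss] at hmain
    have eθ : β ^ 2 * ((∫ W, F W * F' W ∂(boxState r.ρ β ⌈β ^ θ⌉₊)) - E1F * E1F') = β ^ 2 * θ0 := by rw [hθ0]
    have eq1 : β ^ 2 * ((∫ W, F W * F' W ∂(boxKernelG r.ρ β ⌈β ^ θ⌉₊ (torusLift (2 * S + 1) U))) -
        (∫ W, F W ∂(boxKernelG r.ρ β ⌈β ^ θ⌉₊ (torusLift (2 * S + 1) U))) *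
          (∫ W, F' W ∂(boxKernelG r.ρ β ⌈β ^ θ⌉₊ (torusLift (2 * S + 1) U)))) = β ^ 2 * (qf U - h U * k U) := by
      rw [hqf, hh, hk]
    have hmain2 : β ^ 2 * (qf U - h U * k U) ≤
        β ^ 2 * θ0 + (K * β ^ (-(4 * A)) * cP * (MF U + MF' U) + cP ^ 2 * (2 * β ^ (-(1 / 5 : ℝ)))) := by
      rw [← eθ, ← eq1]; exact hmain
    have hΦU : β ^ 2 * Φ U = K * β ^ (-(4 * A)) * cP * (MF U + MF' U) + cP ^ 2 * (2 * β ^ (-(1 / 5 : ℝ))) := by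
      rw [hΦ]; simp only
      rw [max_eq_left hMF0, max_eq_left hMF0', hc₁, hc₀]
      field_simp
    have key' : β ^ 2 * (qf U - h U * k U) ≤ β ^ 2 * (θ0 + Φ U) := by
      rw [mul_add, hΦU]; exact hmain2
    exact le_of_mul_le_mul_left key' hβ2
  have hdevh : ∀ U, U ∉ E → |h U - E1F| ≤ Ψ U := by
    intro U hU
    obtain ⟨hn1, -, -⟩ := hupβ β hba (torusLift (2 * S + 1) U) (hgood U hU)
    obtain ⟨hMF0, -⟩ := hMFnn U hU
    have h1 := abs_sum_sub_sum_le_of_planes hβ0 _ _ (fun q => (hn1 q).2.2)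
    rw [hMF_eq U, ← hhU U, ← hE1F_sum] at h1
    rw [hΨ]; simp only
    rw [max_eq_left hMF0]
    exact h1
  have hdevk : ∀ U, U ∉ E → |k U - E1F'| ≤ Ψ' U := by
    intro U hU
    obtain ⟨-, hn2, -⟩ := hupβ β hba (torusLift (2 * S + 1) U) (hgood U hU)
    obtain ⟨-, hMF0'⟩ := hMFnn U hU
    have h1 := abs_sum_sub_sum_le_of_planes hβ0 _ _ (fun q => (hn2 q).2.2)
    rw [hMF'_eq U, ← hkU U, ← hE1F'_sum] at h1
    rw [hΨ']; simp only
    rw [max_eq_left hMF0']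
    exact h1
  have hσU : ∀ U, U ∉ E → Ψ U ≤ σ := by
    intro U hU
    obtain ⟨hMF0, -⟩ := hMFnn U hU
    rw [hΨ, hσ]; simp only
    rw [max_eq_left hMF0]
    exact mul_le_mul_of_nonneg_left (by linarith [hMFsup U hU]) (inv_nonneg.2 hβ0.le)
  have key := total_covariance_upper_bound_dev hEm hhm hkm hqm hΦi hΨi hΨi' hhK hkK hqK hE1FK hE1FK' hΦ0 hΨ0 hΨ'0 hσ0
    hup hdevh hdevk hσU hμE
  have htorus : latticeConnectedCorr r.ρ β (2 * S + 1) (actionDensity r.ρ) (actionDensity r.ρ) ⌈β ^ A⌉₊ =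
      (∫ U, qf U ∂μ) - (∫ U, h U ∂μ) * ∫ U, k U ∂μ := sixPlane_torusCorr_eq_kernel r.ρ hρc hρu β hL
  have hinth : ∫ U, h U ∂μ = ∑ q : {q : Fin 4 × Fin 4 // q.1 < q.2},
      ∫ U, plaqCost0 r.ρ q.1.1 q.1.2 (torusLift (2 * S + 1) U) ∂μ := (sixPlane_torusMean_eq r.ρ hρc hρu β hL).1
  have hintk : ∫ U, k U ∂μ = ∑ q : {q : Fin 4 × Fin 4 // q.1 < q.2},
      ∫ U, plaqCost0 r.ρ q.1.1 q.1.2 (torusLift (2 * S + 1) U) ∂μ := (sixPlane_torusMean_eq r.ρ hρc hρu β hL).2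
  have hMFi : Integrable MF μ := bdd CM hMFm hMFK
  have hMFi' : Integrable MF' μ := bdd CM hMFm' hMFK'
  have hindi : Integrable (fun U => E.indicator (fun _ => (1 : ℝ)) U) μ := (integrable_const 1).indicator hEm
  have hind_int : ∫ U, E.indicator (fun _ => (1 : ℝ)) U ∂μ = μ.real E := by
    rw [integral_indicator_const _ hEm]; simp
  have hΦle : ∀ U, Φ U ≤ c₁ * MF U + c₁ * MF' U + c₁ * (2 * CM) * E.indicator (fun _ => (1 : ℝ)) U + c₀ := by
    intro U
    have h1 := max_zero_le_add_indicator E (f := MF) (fun U hU => (hMFnn U hU).1) hMFK U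
    have h2 := max_zero_le_add_indicator E (f := MF') (fun U hU => (hMFnn U hU).2) hMFK' U
    rw [hΦ]; simp only
    calc c₁ * (max (MF U) 0 + max (MF' U) 0) + c₀
        ≤ c₁ * ((MF U + CM * E.indicator (fun _ => (1 : ℝ)) U) + (MF' U + CM * E.indicator (fun _ => (1 : ℝ)) U)) + c₀ := by
          gcongr
      _ = c₁ * MF U + c₁ * MF' U + c₁ * (2 * CM) * E.indicator (fun _ => (1 : ℝ)) U + c₀ := by ring
  have hintΦ : ∫ U, Φ U ∂μ ≤ c₁ * (∫ U, MF U ∂μ) + c₁ * (∫ U, MF' U ∂μ) + c₁ * (2 * CM) * p + c₀ := by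
    have hRi : Integrable (fun U => c₁ * MF U + c₁ * MF' U + c₁ * (2 * CM) * E.indicator (fun _ => (1 : ℝ)) U + c₀) μ :=
      (((hMFi.const_mul c₁).add (hMFi'.const_mul c₁)).add (hindi.const_mul _)).add (integrable_const _)
    refine (integral_mono hΦi hRi hΦle).trans ?_
    rw [integral_floor_eq μ hMFi hMFi' hEm c₁ (c₁ * (2 * CM)) c₀]
    have : c₁ * (2 * CM) * μ.real E ≤ c₁ * (2 * CM) * p := mul_le_mul_of_nonneg_left hμE (by positivity)
    linarith
  have hintΨ : ∫ U, Ψ U ∂μ ≤ β⁻¹ * ((∫ U, MF U ∂μ) + CM * p + cP * (2 * β ^ (-(1 / 4 : ℝ)))) :=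
    integral_dev_le hEm hMFi hβ0 hCM0 (fun U hU => (hMFnn U hU).1) hMFK hΨi hμE
  have hintΨ' : ∫ U, Ψ' U ∂μ ≤ β⁻¹ * ((∫ U, MF' U ∂μ) + CM * p + cP * (2 * β ^ (-(1 / 4 : ℝ)))) :=
    integral_dev_le hEm hMFi' hβ0 hCM0 (fun U hU => (hMFnn U hU).2) hMFK' hΨi' hμE
  have hTq : ∀ q : {q : Fin 4 × Fin 4 // q.1 < q.2},
      (∫ U, plaqCost0 r.ρ q.1.1 q.1.2 (torusLift (2 * S + 1) U) ∂μ) -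
        (∫ W, plaqCostAt r.ρ (boxCentre ⌈β ^ θ⌉₊) q.1.1 q.1.2 W ∂(boxState r.ρ β ⌈β ^ θ⌉₊)) ≤ β ^ (-(1 + 3 * θ)) :=
    fun q => hS₁ S hS1 q.1.1 q.1.2 q.2
  have hflat : ∀ q : {q : Fin 4 × Fin 4 // q.1 < q.2},
      |(∫ W, plaqCostAt r.ρ (boxCentre ⌈β ^ θ⌉₊ + Pi.single 0 (⌈β ^ A⌉₊ : ℤ)) q.1.1 q.1.2 W ∂(boxState r.ρ β ⌈β ^ θ⌉₊)) -
          (∫ W, plaqCostAt r.ρ (boxCentre ⌈β ^ θ⌉₊) q.1.1 q.1.2 W ∂(boxState r.ρ β ⌈β ^ θ⌉₊))| ≤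
        |Kf q| * (β ^ (2 * (θ / 5) - 1) * (⌈β ^ A⌉₊ : ℝ) / (⌈β ^ θ⌉₊ : ℝ)) := fun q => by
    have h := hKf q β (hbfq q) (fun _ => 1) (crudeGoodG_one r.ρ hβ0.le _)
    rw [boxKernelG_one] at h
    refine h.trans ?_
    have hnum : 0 ≤ β ^ (2 * (θ / 5) - 1) * (⌈β ^ A⌉₊ : ℝ) / (⌈β ^ θ⌉₊ : ℝ) := by positivity
    calc Kf q * β ^ (2 * (θ / 5) - 1) * (⌈β ^ A⌉₊ : ℝ) / (⌈β ^ θ⌉₊ : ℝ) = Kf q * (β ^ (2 * (θ / 5) - 1) * (⌈β ^ A⌉₊ : ℝ) / (⌈β ^ θ⌉₊ : ℝ)) := by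
          ring
      _ ≤ |Kf q| * (β ^ (2 * (θ / 5) - 1) * (⌈β ^ A⌉₊ : ℝ) / (⌈β ^ θ⌉₊ : ℝ)) := mul_le_mul_of_nonneg_right (le_abs_self _) hnum
  have hintMF : ∫ U, MF U ∂μ ≤ β * (cP * β ^ (-(1 + 3 * θ))) + cP * (2 * β ^ (-(1 / 4 : ℝ))) := by
    have e : ∫ U, MF U ∂μ = β * ((∫ U, h U ∂μ) - E1F) + cP * (2 * β ^ (-(1 / 4 : ℝ))) := integral_affine_eq μ hhi β E1F _
    rw [e, hinth, hE1F_sum, ← Finset.sum_sub_distrib]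
    have hs : ∑ q : {q : Fin 4 × Fin 4 // q.1 < q.2},
        ((∫ U, plaqCost0 r.ρ q.1.1 q.1.2 (torusLift (2 * S + 1) U) ∂μ) -
          ∫ W, plaqCostAt r.ρ (boxCentre ⌈β ^ θ⌉₊) q.1.1 q.1.2 W ∂(boxState r.ρ β ⌈β ^ θ⌉₊)) ≤ cP * β ^ (-(1 + 3 * θ)) := by
      calc _ ≤ ∑ _q : {q : Fin 4 × Fin 4 // q.1 < q.2}, β ^ (-(1 + 3 * θ)) := Finset.sum_le_sum fun q _ => hTq q
        _ = cP * β ^ (-(1 + 3 * θ)) := by rw [Finset.sum_const, Finset.card_univ, nsmul_eq_mul]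
    linarith [mul_le_mul_of_nonneg_left hs hβ0.le]
  have hintMF' : ∫ U, MF' U ∂μ ≤ β * (cP * β ^ (-(1 + 3 * θ)) +
      SKf * (β ^ (2 * (θ / 5) - 1) * (⌈β ^ A⌉₊ : ℝ) / (⌈β ^ θ⌉₊ : ℝ))) + cP * (2 * β ^ (-(1 / 4 : ℝ))) := by
    have e : ∫ U, MF' U ∂μ = β * ((∫ U, k U ∂μ) - E1F') + cP * (2 * β ^ (-(1 / 4 : ℝ))) := integral_affine_eq μ hki β E1F' _
    rw [e, hintk, hE1F'_sum, ← Finset.sum_sub_distrib]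
    have hs : ∑ q : {q : Fin 4 × Fin 4 // q.1 < q.2},
        ((∫ U, plaqCost0 r.ρ q.1.1 q.1.2 (torusLift (2 * S + 1) U) ∂μ) -
          ∫ W, plaqCostAt r.ρ (boxCentre ⌈β ^ θ⌉₊ + Pi.single 0 (⌈β ^ A⌉₊ : ℤ)) q.1.1 q.1.2 W ∂(boxState r.ρ β ⌈β ^ θ⌉₊)) ≤
        cP * β ^ (-(1 + 3 * θ)) + SKf * (β ^ (2 * (θ / 5) - 1) * (⌈β ^ A⌉₊ : ℝ) / (⌈β ^ θ⌉₊ : ℝ)) := by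
      calc _ ≤ ∑ q : {q : Fin 4 × Fin 4 // q.1 < q.2},
            (β ^ (-(1 + 3 * θ)) + |Kf q| * (β ^ (2 * (θ / 5) - 1) * (⌈β ^ A⌉₊ : ℝ) / (⌈β ^ θ⌉₊ : ℝ))) :=
            Finset.sum_le_sum fun q _ => by
              have h1 := hTq q; have h2 := (abs_le.1 (hflat q)).1
              linarith
        _ = cP * β ^ (-(1 + 3 * θ)) + SKf * (β ^ (2 * (θ / 5) - 1) * (⌈β ^ A⌉₊ : ℝ) / (⌈β ^ θ⌉₊ : ℝ)) := by
            rw [Finset.sum_add_distrib, Finset.sum_const, Finset.card_univ, nsmul_eq_mul, hSKf, Finset.sum_mul]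
    linarith [mul_le_mul_of_nonneg_left hs hβ0.le]
  have hp_le : p ≤ 6 * 2401 * (β ^ (4 * θ) * Real.exp (-(β ^ (θ / 5)))) := badMass_le_rpow hβ1 hθ.le hH2
  have hθ0K : |θ0| ≤ 2 * C₆ ^ 2 := by
    have h1 : |∫ W, F W * F' W ∂(boxState r.ρ β ⌈β ^ θ⌉₊)| ≤ C₆ ^ 2 := abs_integral_le_of_abs_le _ hFFK
    have h2 : |E1F * E1F'| ≤ C₆ ^ 2 := by rw [abs_mul, sq]; exact mul_le_mul hE1FK hE1FK' (abs_nonneg _) hC₆0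
    linarith [abs_sub (∫ W, F W * F' W ∂(boxState r.ρ β ⌈β ^ θ⌉₊)) (E1F * E1F')]
  have hB := hβe β hbe p hp0 hp_le
  rw [← hCM] at hB
  set IΨ : ℝ := ∫ U, Ψ U ∂μ with hIΨ
  set IΨ' : ℝ := ∫ U, Ψ' U ∂μ with hIΨ'
  set BM : ℝ := β * (cP * β ^ (-(1 + 3 * θ))) + cP * (2 * β ^ (-(1 / 4 : ℝ))) with hBM
  set BM' : ℝ := β * (cP * β ^ (-(1 + 3 * θ)) + SKf * (β ^ (2 * (θ / 5) - 1) * (⌈β ^ A⌉₊ : ℝ) / (⌈β ^ θ⌉₊ : ℝ))) +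
    cP * (2 * β ^ (-(1 / 4 : ℝ))) with hBM'
  set Bσ : ℝ := cP * (CS * β ^ (2 * (θ / 5)) + 4 * β ^ (-(1 / 4 : ℝ))) + cP * (2 * β ^ (-(1 / 4 : ℝ))) with hBσ
  obtain ⟨hIΨ0, hIΨ'0⟩ : 0 ≤ IΨ ∧ 0 ≤ IΨ' := ⟨integral_nonneg hΨ0, integral_nonneg hΨ'0⟩
  have hΦ2 : β ^ 2 * (∫ U, Φ U ∂μ) ≤ K * β ^ (-(4 * A)) * cP * (BM + BM' + 2 * CM * p) + cP ^ 2 * (2 * β ^ (-(1 / 5 : ℝ))) := by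
    have h1 := mul_le_mul_of_nonneg_left hintΦ hβ2.le
    have e : β ^ 2 * (c₁ * (∫ U, MF U ∂μ) + c₁ * (∫ U, MF' U ∂μ) + c₁ * (2 * CM) * p + c₀) =
        K * β ^ (-(4 * A)) * cP * ((∫ U, MF U ∂μ) + (∫ U, MF' U ∂μ) + 2 * CM * p) + cP ^ 2 * (2 * β ^ (-(1 / 5 : ℝ))) := by
      rw [hc₁, hc₀]; field_simp
    have hKc : 0 ≤ K * β ^ (-(4 * A)) * cP := by positivity
    have h2 : K * β ^ (-(4 * A)) * cP * ((∫ U, MF U ∂μ) + (∫ U, MF' U ∂μ) + 2 * CM * p) ≤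
        K * β ^ (-(4 * A)) * cP * (BM + BM' + 2 * CM * p) :=
      mul_le_mul_of_nonneg_left (by linarith [hintMF, hintMF']) hKc
    linarith
  have hβIΨ' : β * IΨ' ≤ BM' + CM * p + cP * (2 * β ^ (-(1 / 4 : ℝ))) := by
    have h1 := mul_le_mul_of_nonneg_left hintΨ' hβ0.le
    rw [← mul_assoc, mul_inv_cancel₀ hβ0.ne', one_mul] at h1
    linarith [hintMF']
  have hβIΨ : β * IΨ ≤ BM + CM * p + cP * (2 * β ^ (-(1 / 4 : ℝ))) := by
    have h1 := mul_le_mul_of_nonneg_left hintΨ hβ0.le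
    rw [← mul_assoc, mul_inv_cancel₀ hβ0.ne', one_mul] at h1
    linarith [hintMF]
  have hBσ0 : 0 ≤ Bσ := by positivity
  have hσ2 : β ^ 2 * (σ * IΨ') ≤ Bσ * (BM' + CM * p + cP * (2 * β ^ (-(1 / 4 : ℝ)))) := by
    have e : β ^ 2 * (σ * IΨ') = Bσ * (β * IΨ') := by
      rw [hσ, hBσ]; field_simp
    rw [e]
    exact mul_le_mul_of_nonneg_left hβIΨ' hBσ0
  have hprod : β ^ 2 * ((IΨ + 2 * C₆ * p) * (IΨ' + 2 * C₆ * p)) ≤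
      (BM + CM * p + cP * (2 * β ^ (-(1 / 4 : ℝ))) + 2 * (β * C₆) * p) * (BM' + CM * p + cP * (2 * β ^ (-(1 / 4 : ℝ))) + 2 * (β * C₆) * p) := by
    have e : β ^ 2 * ((IΨ + 2 * C₆ * p) * (IΨ' + 2 * C₆ * p)) = (β * IΨ + 2 * (β * C₆) * p) * (β * IΨ' + 2 * (β * C₆) * p) := by ring
    rw [e]
    have h1 : β * IΨ + 2 * (β * C₆) * p ≤ BM + CM * p + cP * (2 * β ^ (-(1 / 4 : ℝ))) + 2 * (β * C₆) * p := by linarith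
    have h2 : β * IΨ' + 2 * (β * C₆) * p ≤ BM' + CM * p + cP * (2 * β ^ (-(1 / 4 : ℝ))) + 2 * (β * C₆) * p := by linarith
    have h10 : 0 ≤ β * IΨ + 2 * (β * C₆) * p := by positivity
    have h20 : 0 ≤ β * IΨ' + 2 * (β * C₆) * p := by positivity
    exact mul_le_mul h1 h2 h20 (h10.trans h1)
  have hbad : β ^ 2 * ((|θ0| + 6 * C₆ ^ 2) * p) ≤ β ^ 2 * ((2 * C₆ ^ 2 + 6 * C₆ ^ 2) * p) := by
    gcongr
  have k1 := mul_le_mul_of_nonneg_left key hβ2.le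
  have hfin : β ^ 2 * ((∫ U, qf U ∂μ) - (∫ U, h U ∂μ) * ∫ U, k U ∂μ) ≤ β ^ 2 * θ0 + β ^ (-(9 * A)) := by
    have e : β ^ 2 * (θ0 + (∫ U, Φ U ∂μ) + σ * IΨ' + (IΨ + 2 * C₆ * p) * (IΨ' + 2 * C₆ * p) + (|θ0| + 6 * C₆ ^ 2) * p) =
        β ^ 2 * θ0 + β ^ 2 * (∫ U, Φ U ∂μ) + β ^ 2 * (σ * IΨ') + β ^ 2 * ((IΨ + 2 * C₆ * p) * (IΨ' + 2 * C₆ * p)) +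
          β ^ 2 * ((|θ0| + 6 * C₆ ^ 2) * p) := by ring
    rw [e] at k1
    linarith only [k1, hΦ2, hσ2, hprod, hbad, hB]
  rw [htorus]
  have e0 : β ^ 2 * θ0 = β ^ 2 * ((∫ U, F U * F' U ∂(boxState r.ρ β ⌈β ^ θ⌉₊)) - E1F * E1F') := by rw [hθ0]
  rw [e0, hE1F, hE1F'] at hfin
  exact hfin

end Summit.QuantumFields.YangMills.Theorems.SixPlaneColdBox

end
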